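import Summits.QuantumFields.YangMills.Theses.PencilRigidity
import Summits.QuantumFields.YangMills.Theorems.LatticeGapOnTrajectory.Negative.ZeroCouplingGap

/-!
# `WeakCouplingHypercubicLimit` (crux stmt-QuantumFields-16120, route PencilRigidity) — negative side:
# what the weak-coupling clause is load-bearing against (the junk floor)

Support file extracted from the standing disprover's work file
`Cruxes/WeakCouplingHypercubicLimit/Disproof.lean` §2 (cycle 1).  The clauses of the crux are quoted
VERBATIM; nothing is defined or posited.  "Junk floor" = every clause of the crux body except
non-triviality and non-Gaussianity (weak coupling, one-field gauge, the OS block, `Converges`, the two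
gaps).

* `junkFloor_without_weakCoupling`: WITHOUT the weak-coupling clause the junk floor is a THEOREM for
  every `G` with a lattice representation and every `r` — the zero scheme (`β ≡ 0`: product Haar
  measure, exact decorrelation; `hasLatticeMassGap_of_zero_coupling`) and the vacuum-only family.
* `junkFloor_false_on_zeroScheme`: the weak-coupling clause alone removes that witness.
* `junkFloor_iff_weakCouplingLatticeGap`: WITH the weak-coupling clause the junk floor holds for `G`
  iff some faithful `r` and some scheme with `β_k → ∞` have the volume-uniform lattice mass gap
  `HasLatticeMassGap r sch Δ`, `Δ > 0` (⇐: silence every species, `c = m ≡ 0`, over the vacuum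
  family; the weak-coupling and lattice-gap clauses read `(a, β, L)` only).  So after the statement
  re-type of 2026-08-16 even the contentless part of the crux is the open weak-coupling IR problem,
  and the two non-triviality clauses are the entire remaining (UV) obstruction. [folklore]
-/

noncomputable section

open scoped SchwartzMap
open MeasureTheory Filter Topology Complex
open Literature.MathematicalPhysics.AQFT Literature.MathematicalPhysics.QuantumLattice
open Literature.MathematicalPhysics.QuantumFieldTheory
open Summit.QuantumFields.YangMills.Theorems.LatticeGapOnTrajectory.Negative

namespace Summit.QuantumFields.YangMills.Theorems.WeakCouplingHypercubicLimit.Negative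

section JunkFloor

variable {G : Type} [Group G] [TopologicalSpace G] [IsTopologicalGroup G] [CompactSpace G]
  [MeasurableSpace G] [BorelSpace G]

omit [TopologicalSpace G] [IsTopologicalGroup G] [CompactSpace G] [BorelSpace G] in
/-- The OS block of the crux (E0, E0', E2, E3, E4, translations and proper signed permutations on
`⁰𝒮`) holds for genuine OS data, in particular for the vacuum-only family. [folklore] -/
theorem osBlock_of_osData (T : OSData (YMSpecies G) 4) :
    (T.schwinger.IsNormalized ∧ T.schwinger.IsHermitian ∧ T.schwinger.HasLinearGrowth ∧ T.schwinger.IsReflectionPositive ∧ T.schwinger.IsSymmetric ∧ T.schwinger.HasClusterProperty ∧ (∀ (n : ℕ) (k : Fin n → YMSpecies G) (a : (EuclideanSpace ℝ (Fin 4))) (F : SchwartzMap (Fin n → (EuclideanSpace ℝ (Fin 4))) ℂ), IsOffDiagonal F → T.schwinger n k (translateMulti a F) = T.schwinger n k F) ∧ (∀ (n : ℕ) (k : Fin n → YMSpecies G) (R : (EuclideanSpace ℝ (Fin 4)) ≃ₗᵢ[ℝ] (EuclideanSpace ℝ (Fin 4))), LinearMap.det (R.toLinearEquiv : (EuclideanSpace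 ℝ (Fin 4)) →ₗ[ℝ] (EuclideanSpace ℝ (Fin 4))) = 1 → (∀ i : Fin 4, ∃ j : Fin 4, R (EuclideanSpace.single i 1) = EuclideanSpace.single j 1 ∨ R (EuclideanSpace.single i 1) = -EuclideanSpace.single j 1) → ∀ F : SchwartzMap (Fin n → (EuclideanSpace ℝ (Fin 4))) ℂ, IsOffDiagonal F → T.schwinger n k (linActMulti R F) = T.schwinger n k F)) :=
  ⟨T.normalized, T.hermitian, T.linearGrowth, T.reflectionPositive, T.symmetric, T.cluster,
    T.invariant.1, fun n k R hdet _ F hF => T.invariant.2 n k R hdet F hF⟩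

/-- Along a scheme with all multiplicative renormalisations zero every lattice `n`-point function,
`n ≥ 1`, vanishes, so the vacuum-only family satisfies the convergence clause. [folklore] -/
theorem converges_vacuum_of_c_eq_zero (r : LatticeRep G) (sch : SpeciesScheme (YMSpecies G))
    (hc : ∀ s k, sch.c s k = 0) :
    (∀ (n : ℕ), n ≠ 0 → ∀ (σ : Fin n → YMSpecies G) (f : Fin n → SchwartzMap (EuclideanSpace ℝ (Fin 4)) ℝ) (F : SchwartzMap (Fin n → (EuclideanSpace ℝ (Fin 4))) ℂ), IsTensorOf F (fun i => ofRealTest (f i)) → IsOffDiagonal F → Filter.Tendsto (fun k : ℕ => ((latticeSchwinger r.ρ sch (fun s => s.F) k n σ f : ℝ) : ℂ)) Filter.atTop (nhds ((OSData.vacuum (YMSpecies G) 4).schwinger n σ F))) := by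
  intro n hn σ f F _ _
  have hS : (OSData.vacuum (YMSpecies G) 4).schwinger n σ F = 0 := by
    simp [OSData.vacuum, LabelledSchwingerFamily.trivial_of_ne_zero (YMSpecies G) hn]
  rw [hS]
  refine tendsto_const_nhds.congr' (Eventually.of_forall fun k => ?_)
  obtain ⟨j, rfl⟩ := Nat.exists_eq_succ_of_ne_zero hn
  simp [latticeSchwinger, smearedLatticeField, hc]

/-- The vacuum-only family is in one-field (indeed zero-field) gauge. [folklore] -/
theorem oneField_vacuum (r : LatticeRep G) :
    (∀ (n : ℕ) (k : Fin n → YMSpecies G), (∃ i, k i ≠ r.curvature) → ∀ F : SchwartzMap (Fin n → (EuclideanSpace ℝ (Fin 4))) ℂ, (OSData.vacuum (YMSpecies G) 4).schwinger n k F = 0) := by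
  rintro n k ⟨i, -⟩ F
  have hn : n ≠ 0 := by rintro rfl; exact i.elim0
  simp [OSData.vacuum, LabelledSchwingerFamily.trivial_of_ne_zero (YMSpecies G) hn]

/-- **Without the weak-coupling clause the junk floor is a theorem**: for every `G` with a lattice
representation and every `r`, the zero scheme and the vacuum-only family satisfy one-field gauge, the
OS block, `Converges` and BOTH gap clauses (with `Δ = 1`).  This is the junk the clause
`sch.HasWeakCouplingLimit` was added against. [folklore] -/
theorem junkFloor_without_weakCoupling (r : LatticeRep G) :
    ∃ (sch : SpeciesScheme (YMSpecies G)) (S : LabelledSchwingerFamily (YMSpecies G) (EuclideanSpace ℝ (Fin 4))),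
      (∀ (n : ℕ) (k : Fin n → YMSpecies G), (∃ i, k i ≠ r.curvature) → ∀ F : SchwartzMap (Fin n → (EuclideanSpace ℝ (Fin 4))) ℂ, S n k F = 0) ∧ (S.IsNormalized ∧ S.IsHermitian ∧ S.HasLinearGrowth ∧ S.IsReflectionPositive ∧ S.IsSymmetric ∧ S.HasClusterProperty ∧ (∀ (n : ℕ) (k : Fin n → YMSpecies G) (a : (EuclideanSpace ℝ (Fin 4))) (F : SchwartzMap (Fin n → (EuclideanSpace ℝ (Fin 4))) ℂ), IsOffDiagonal F → S n k (translateMulti a F) = S n k F) ∧ (∀ (n : ℕ) (k : Fin n → YMSpecies G) (R : (EuclideanSpace ℝ (Fin 4)) ≃ₗᵢ[ℝ] (EuclideanSpace ℝ (Fin 4))), LinearMap.det (R.toLinearEquiv : (EuclideanSpace ℝ (Fin 4)) →ₗ[ℝ] (EuclideanSpace ℝ (Fin 4))) = 1 → (∀ i : Fin 4, ∃ j : Fin 4, R (EuclideanSpace.single i 1) = EuclideanSpace.single j 1 ∨ R (EuclideanSpace.single i 1) = -EuclideanSpace.single j 1) → ∀ F : SchwartzMap (Fin n → (EuclideanSpace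 ℝ (Fin 4))) ℂ, IsOffDiagonal F → S n k (linActMulti R F) = S n k F)) ∧ (∀ (n : ℕ), n ≠ 0 → ∀ (σ : Fin n → YMSpecies G) (f : Fin n → SchwartzMap (EuclideanSpace ℝ (Fin 4)) ℝ) (F : SchwartzMap (Fin n → (EuclideanSpace ℝ (Fin 4))) ℂ), IsTensorOf F (fun i => ofRealTest (f i)) → IsOffDiagonal F → Filter.Tendsto (fun k : ℕ => ((latticeSchwinger r.ρ sch (fun s => s.F) k n σ f : ℝ) : ℂ)) Filter.atTop (nhds (S n σ F))) ∧ (∃ Δ : ℝ, 0 < Δ ∧ S.HasMassGap Δ ∧ HasLatticeMassGap r sch Δ) :=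
  ⟨SpeciesScheme.zero _, (OSData.vacuum (YMSpecies G) 4).schwinger, oneField_vacuum r, osBlock_of_osData _,
    converges_vacuum_of_c_eq_zero r _ (fun _ _ => rfl), 1, one_pos, OSData.vacuum_hasMassGap 1,
    hasLatticeMassGap_of_zero_coupling r _ (fun _ => rfl) 1⟩

/-- …and the weak-coupling clause alone removes that witness: no family rides the zero scheme. [folklore] -/
theorem junkFloor_false_on_zeroScheme (r : LatticeRep G) (S : LabelledSchwingerFamily (YMSpecies G) (EuclideanSpace ℝ (Fin 4))) :
    ¬ ((SpeciesScheme.zero (YMSpecies G)).HasWeakCouplingLimit ∧ (∀ (n : ℕ) (k : Fin n → YMSpecies G), (∃ i, k i ≠ r.curvature) → ∀ F : SchwartzMap (Fin n → (EuclideanSpace ℝ (Fin 4))) ℂ, S n k F = 0) ∧ (S.IsNormalized ∧ S.IsHermitian ∧ S.HasLinearGrowth ∧ S.IsReflectionPositive ∧ S.IsSymmetric ∧ S.HasClusterProperty ∧ (∀ (n : ℕ) (k : Fin n → YMSpecies G) (a : (EuclideanSpace ℝ (Fin 4))) (F : SchwartzMap (Fin n → (EuclideanSpace ℝ (Fin 4)))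 ℂ), IsOffDiagonal F → S n k (translateMulti a F) = S n k F) ∧ (∀ (n : ℕ) (k : Fin n → YMSpecies G) (R : (EuclideanSpace ℝ (Fin 4)) ≃ₗᵢ[ℝ] (EuclideanSpace ℝ (Fin 4))), LinearMap.det (R.toLinearEquiv : (EuclideanSpace ℝ (Fin 4)) →ₗ[ℝ] (EuclideanSpace ℝ (Fin 4))) = 1 → (∀ i : Fin 4, ∃ j : Fin 4, R (EuclideanSpace.single i 1) = EuclideanSpace.single j 1 ∨ R (EuclideanSpace.single i 1) = -EuclideanSpace.single j 1) → ∀ F : SchwartzMap (Fin n → (EuclideanSpace ℝ (Fin 4))) ℂ, IsOffDiagonal F → S n k (linActMulti R F) = S n k F)) ∧ (∀ (n : ℕ), n ≠ 0 → ∀ (σ : Fin n → YMSpecies G) (f : Fin n → SchwartzMap (EuclideanSpace ℝ (Fin 4)) ℝ) (F : SchwartzMap (Fin n → (EuclideanSpace ℝ (Fin 4))) ℂ), IsTensorOf F (fun i => ofRealTest (f i)) → IsOffDiagonal F → Filter.Tendsto (fun k : ℕ => ((latticeSchwinger r.ρ (SpeciesScheme.zero (YMSpecies G)) (fun s => s.F)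 k n σ f : ℝ) : ℂ)) Filter.atTop (nhds (S n σ F))) ∧ (∃ Δ : ℝ, 0 < Δ ∧ S.HasMassGap Δ ∧ HasLatticeMassGap r (SpeciesScheme.zero (YMSpecies G)) Δ)) :=
  fun h => SpeciesScheme.not_hasWeakCouplingLimit_zero h.1

/-- **The junk floor of the crux ⇔ a weak-coupling lattice mass gap along some scheme.**  With the
weak-coupling clause, "every clause of `PencilRigidity.WeakCouplingHypercubicLimit` except
non-triviality and non-Gaussianity" holds for `G` iff some faithful `r` and some scheme with
`β_k → ∞` have the volume-uniform lattice gap — the IR half of the problem, no longer free at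
`β_k → ∞`; the two non-triviality clauses are the whole remaining obstruction. [folklore] -/
theorem junkFloor_iff_weakCouplingLatticeGap :
    (∃ (r : LatticeRep G) (sch : SpeciesScheme (YMSpecies G)) (S : LabelledSchwingerFamily (YMSpecies G) (EuclideanSpace ℝ (Fin 4))),
        sch.HasWeakCouplingLimit ∧ (∀ (n : ℕ) (k : Fin n → YMSpecies G), (∃ i, k i ≠ r.curvature) → ∀ F : SchwartzMap (Fin n → (EuclideanSpace ℝ (Fin 4))) ℂ, S n k F = 0) ∧ (S.IsNormalized ∧ S.IsHermitian ∧ S.HasLinearGrowth ∧ S.IsReflectionPositive ∧ S.IsSymmetric ∧ S.HasClusterProperty ∧ (∀ (n : ℕ) (k : Fin n → YMSpecies G) (a : (EuclideanSpace ℝ (Fin 4))) (F : SchwartzMap (Fin n → (EuclideanSpace ℝ (Fin 4))) ℂ), IsOffDiagonal F → S n k (translateMulti a F) = S n k F) ∧ (∀ (n : ℕ) (k : Fin n → YMSpecies G) (R : (EuclideanSpace ℝ (Fin 4)) ≃ₗᵢ[ℝ] (EuclideanSpace ℝ (Fin 4))), LinearMap.det (R.toLinearEquiv : (EuclideanSpace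 ℝ (Fin 4)) →ₗ[ℝ] (EuclideanSpace ℝ (Fin 4))) = 1 → (∀ i : Fin 4, ∃ j : Fin 4, R (EuclideanSpace.single i 1) = EuclideanSpace.single j 1 ∨ R (EuclideanSpace.single i 1) = -EuclideanSpace.single j 1) → ∀ F : SchwartzMap (Fin n → (EuclideanSpace ℝ (Fin 4))) ℂ, IsOffDiagonal F → S n k (linActMulti R F) = S n k F)) ∧ (∀ (n : ℕ), n ≠ 0 → ∀ (σ : Fin n → YMSpecies G) (f : Fin n → SchwartzMap (EuclideanSpace ℝ (Fin 4)) ℝ) (F : SchwartzMap (Fin n → (EuclideanSpace ℝ (Fin 4))) ℂ), IsTensorOf F (fun i => ofRealTest (f i)) → IsOffDiagonal F → Filter.Tendsto (fun k : ℕ => ((latticeSchwinger r.ρ sch (fun s => s.F) k n σ f : ℝ) : ℂ)) Filter.atTop (nhds (S n σ F))) ∧ (∃ Δ : ℝ, 0 < Δ ∧ S.HasMassGap Δ ∧ HasLatticeMassGap r sch Δ)) ↔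
      ∃ (r : LatticeRep G) (sch : SpeciesScheme (YMSpecies G)),
        sch.HasWeakCouplingLimit ∧ ∃ Δ : ℝ, 0 < Δ ∧ HasLatticeMassGap r sch Δ := by
  constructor
  · rintro ⟨r, sch, S, hweak, -, -, -, Δ, hΔ, -, hlat⟩
    exact ⟨r, sch, hweak, Δ, hΔ, hlat⟩
  · rintro ⟨r, sch, hweak, Δ, hΔ, hlat⟩
    exact ⟨r, { sch with c := fun _ _ => 0, m := fun _ _ => 0 }, (OSData.vacuum (YMSpecies G) 4).schwinger, hweak, oneField_vacuum r,
      osBlock_of_osData _, converges_vacuum_of_c_eq_zero r _ (fun _ _ => rfl), Δ, hΔ,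
      OSData.vacuum_hasMassGap Δ, hlat⟩

end JunkFloor

end Summit.QuantumFields.YangMills.Theorems.WeakCouplingHypercubicLimit.Negative

end
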